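import Mathlib
import HarnessLib
import Literature.Analysis.SpecialFunctions.EulerMascheroniSharpBounds
import Summits.RiemannHypothesis.RiemannHypothesis.Theorems.IntegerScrewRungCertTableNSound
import Summits.RiemannHypothesis.RiemannHypothesis.Theorems.IntegerScrewRungCertKronPacked

/-!
# Route `IntegerScrew` — kernel certificate checker: assembly from SEPARATELY decided light pieces (for `S_512 ≻ 0` and beyond)

At `N = 511` the light part of the rung certificate no longer fits one `decide +kernel` (the farm kernel's per-decide allocation cap:
`rungLightW 511 …` as one decide dies with «excessive memory consumption», so do the first-column identity and, marginally, the factor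
shape checks and the log-table identity `logs = FI.logTable 512`; measured by screw-kernel-2, 2026-08-26).  This module restates the
assembly so that every light fact is its own small decide:
* §1 `slopeEnclT` / `mem_slopeEnclT` — a TIGHT enclosure of the slope `A = γ₀ + π/2 + 3 log 2 + log π` (γ₀ to 16 digits from
  `EulerMascheroniSharpBounds`; the engine's `slopeEncl` has width `1.3·10⁻⁷`, which at `N = 511` contributes a Gershgorin radius
  `ρ ≈ 2.1·10⁻⁴ ≈ λ_min/2` and at `N = 1023` would exceed `λ_min`); either slope enclosure can feed the assembly below;
* §2 `logStepOK` / `logStepsOK` / `logBaseOK` and ★ `mem_log_of_logSteps` — the logarithm table validated ENTRYWISE by the step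
  `log(n+1) = log n − log(1 − 1/(n+1))` (`FI.mem_log_succ`) against the literal neighbours, so that the check splits into ranges of `n`
  (the identity `logs = FI.logTable M` recomputes the whole chain in one decide);
* §3 `unpackRowsZ_append`, `lzOK_append`, `absBoundOK_append` — the factor's shape / size guards decided per packed part;
* §4 ★ `posDef_of_pieces`, `quadForm_ge_of_pieces`, `screwPivot_pos_of_pieces` — `screwMatrix N ≻ 0` and the bound
  `(lamZ/2^49)‖v‖² ≤ vᵀ S_{N+1} v` from: `lamTabOK`, `sqrtTabOK`, the log memberships, a slope membership `A ∈ slopeA`, `lzOK`,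
  `0 < lamZ`, and the indexed row tests on `uTableNA lam sqs logs A N TB` (the proofs of `posDef_of_rungW_mem` /
  `quadForm_ge_of_rungW_mem` of `IntegerScrewRungCertTableNSound` with the conjunction `rungLightW` replaced by its pieces).
Every rung is an RH-consequence made unconditional by computation; nothing here bears on the truth of RH.
References: S. M. Rump, Acta Numerica 19 (2010) §10.8 [folklore]; M. Suzuki, J. Lond. Math. Soc. (2) 108 (2023), (1.1) [Suzuki2023].
-/

set_option linter.dupNamespace false
set_option autoImplicit false

namespace Summit.RiemannHypothesis.RiemannHypothesis.Theorems.IntegerScrew.RungCert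

open Literature.NumberTheory.LFunctions Literature.Analysis.ValidatedNumerics Finset
open Literature.Analysis.ValidatedNumerics.Numerics
open scoped BigOperators

/-! ## §1 The tight slope enclosure -/

/-- **Tight enclosure of `A = γ₀ + π/2 + 3 log 2 + log π`** (`log π = 2 log 2 + log(1 − (1 − π/4))`), with `γ₀` bracketed to
16 digits; `none` if the engine declines the logarithm. [folklore] -/
def slopeEnclT (logs : List FI) : Option FI :=
  match FI.logOneSub ((FI.ofInt 1).sub (FI.pi.divNat 4)) 40 with
  | none => none
  | some l => some ((((FI.ofRatRat (5772156649015328 / 10000000000000000) (5772156649015405 / 10000000000000000)).add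
      (FI.pi.divNat 2)).add ((lg logs 2).mulInt 3)).add (((lg logs 2).mulInt 2).add l))

/-- **The slope constant is enclosed, tightly**: `A = γ₀ + π/2 + 3 log 2 + log π ∈ slopeEnclT logs`. [folklore] -/
theorem mem_slopeEnclT {logs : List FI} {K : ℕ} (hL : ∀ n ≤ K, FI.mem (Real.log n) (lg logs n)) (hK : 2 ≤ K) {A : FI}
    (h : slopeEnclT logs = some A) :
    FI.mem (Real.eulerMascheroniConstant + Real.pi / 2 + 3 * Real.log 2 + Real.log Real.pi) A := by
  unfold slopeEnclT at h
  split at h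
  · exact absurd h (by simp)
  · rename_i l hl
    simp only [Option.some.injEq] at h
    subst h
    have hy : FI.mem (1 - Real.pi / 4) ((FI.ofInt 1).sub (FI.pi.divNat 4)) := by
      have := FI.mem_sub (FI.mem_ofInt 1) (FI.mem_divNat FI.mem_pi (n := 4) (by norm_num))
      simpa using this
    have hlog := FI.mem_logOneSub hl hy
    have hγ : FI.mem Real.eulerMascheroniConstant
        (FI.ofRatRat (5772156649015328 / 10000000000000000) (5772156649015405 / 10000000000000000)) := by
      refine FI.mem_ofRatRat ?_ ?_
      · have := Literature.Analysis.SpecialFunctions.Real.eulerMascheroniConstant_gt_d16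
        push_cast; linarith
      · have := Literature.Analysis.SpecialFunctions.Real.eulerMascheroniConstant_lt_d16
        push_cast; linarith
    have h2 : FI.mem (Real.log 2) (lg logs 2) := by simpa using hL 2 hK
    have hpi : Real.log Real.pi = Real.log 2 * (2 : ℤ) + Real.log (1 - (1 - Real.pi / 4)) := by
      rw [sub_sub_cancel, Real.log_div Real.pi_pos.ne' (by norm_num),
        show (4 : ℝ) = 2 ^ 2 by norm_num, Real.log_pow]
      push_cast; ring
    have := FI.mem_add (FI.mem_add (FI.mem_add hγ (FI.mem_divNat FI.mem_pi (n := 2) (by norm_num)))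
      (FI.mem_mulInt h2 3)) (FI.mem_add (FI.mem_mulInt h2 2) hlog)
    rw [← hpi] at this
    convert this using 1
    push_cast; ring

/-- The engine's slope enclosure also gives a slope membership (restated from `mem_slopeEncl` for the pieces assembly). [folklore] -/
theorem mem_slopeA_of_slopeEncl {logs : List FI} {K : ℕ} (hL : ∀ n ≤ K, FI.mem (Real.log n) (lg logs n)) (hK : 2 ≤ K)
    {A : FI} (h : slopeEncl logs = some A) : FI.mem slopeA A :=
  mem_slopeEncl hL hK h

/-- … and so does the tight one. [folklore] -/
theorem mem_slopeA_of_slopeEnclT {logs : List FI} {K : ℕ} (hL : ∀ n ≤ K, FI.mem (Real.log n) (lg logs n)) (hK : 2 ≤ K)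
    {A : FI} (h : slopeEnclT logs = some A) : FI.mem slopeA A :=
  mem_slopeEnclT hL hK h

/-! ## §2 The logarithm table validated entrywise (splittable into ranges) -/

/-- Step `n → n+1` of the log table holds for the literal: the engine accepts `log(1 − 1/(n+1))`, and the literal entry `n+1`
CONTAINS `logs[n] − logOneSubD(1/(n+1))`. [folklore] -/
def logStepOK (logs : List FI) (n : ℕ) : Bool :=
  let J := (lg logs n).sub (FI.logOneSubD (FI.ofFrac 1 (n + 1)) FI.logTerms)
  FI.logOneSubOK (FI.ofFrac 1 (n + 1)) FI.logTerms &&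
    (decide ((lg logs (n + 1)).lo ≤ J.lo) && decide (J.hi ≤ (lg logs (n + 1)).hi))

/-- The steps `n₀, n₀+1, …, n₀+cnt−1` (a range; decide several of these instead of one chain). [folklore] -/
def logStepsOK (logs : List FI) : ℕ → ℕ → Bool
  | _, 0 => true
  | n, c + 1 => logStepOK logs n && logStepsOK logs (n + 1) c

/-- The base entries contain `0 = log 0 = log 1`. [folklore] -/
def logBaseOK (logs : List FI) : Bool :=
  decide ((lg logs 0).lo ≤ 0) && decide (0 ≤ (lg logs 0).hi) && decide ((lg logs 1).lo ≤ 0) && decide (0 ≤ (lg logs 1).hi)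

/-- Membership is monotone under containment of the endpoints. [folklore] -/
theorem mem_of_mem_of_le {x : ℝ} {I J : FI} (h : FI.mem x J) (hlo : I.lo ≤ J.lo) (hhi : J.hi ≤ I.hi) : FI.mem x I := by
  obtain ⟨h1, h2⟩ := h
  exact ⟨le_trans (by exact_mod_cast hlo) h1, le_trans h2 (by exact_mod_cast hhi)⟩

/-- A range of steps gives each step. [folklore] -/
theorem logStepOK_of_logStepsOK {logs : List FI} : ∀ (c n₀ : ℕ), logStepsOK logs n₀ c = true →
    ∀ n, n₀ ≤ n → n < n₀ + c → logStepOK logs n = true := by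
  intro c
  induction c with
  | zero => intro n₀ _ n h1 h2; omega
  | succ c ih =>
      intro n₀ h n h1 h2
      rw [logStepsOK, Bool.and_eq_true] at h
      rcases Nat.eq_or_lt_of_le h1 with rfl | hlt
      · exact h.1
      · exact ih (n₀ + 1) h.2 n (by omega) (by omega)

/-- One validated step transports membership. [folklore] -/
theorem mem_log_succ_of_logStepOK {logs : List FI} {n : ℕ} (hn : 1 ≤ n) (h : logStepOK logs n = true)
    (hcur : FI.mem (Real.log n) (lg logs n)) : FI.mem (Real.log ((n + 1 : ℕ) : ℝ)) (lg logs (n + 1)) := by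
  simp only [logStepOK, Bool.and_eq_true, decide_eq_true_eq] at h
  obtain ⟨hok, hlo, hhi⟩ := h
  exact mem_of_mem_of_le (FI.mem_log_succ hn hcur hok) hlo hhi

/-- ★ **The log table from its pieces**: base entries and every step `1 ≤ n < M` validated ⇒ `log n ∈ logs[n]` for all `n ≤ M`. [folklore] -/
theorem mem_log_of_logSteps {logs : List FI} {M : ℕ} (hb : logBaseOK logs = true)
    (hs : ∀ n, 1 ≤ n → n < M → logStepOK logs n = true) : ∀ n ≤ M, FI.mem (Real.log n) (lg logs n) := by
  simp only [logBaseOK, Bool.and_eq_true, decide_eq_true_eq] at hb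
  obtain ⟨⟨⟨h0l, h0h⟩, h1l⟩, h1h⟩ := hb
  have base0 : FI.mem (Real.log ((0 : ℕ) : ℝ)) (lg logs 0) := by
    refine ⟨?_, ?_⟩ <;> simp only [Nat.cast_zero, Real.log_zero, zero_mul] <;> exact_mod_cast (by assumption)
  have base1 : FI.mem (Real.log ((1 : ℕ) : ℝ)) (lg logs 1) := by
    refine ⟨?_, ?_⟩ <;> simp only [Nat.cast_one, Real.log_one, zero_mul] <;> exact_mod_cast (by assumption)
  intro n
  induction n with
  | zero => exact fun _ => base0
  | succ k ih =>
      intro hk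
      rcases Nat.eq_zero_or_pos k with rfl | hkpos
      · exact base1
      · exact mem_log_succ_of_logStepOK hkpos (hs k hkpos (by omega)) (ih (by omega))

/-! ## §3 The factor's guards per packed part -/

/-- Decoding distributes over appended parts (row offsets continue). [folklore] -/
theorem unpackRowsZ_append (B O : ℕ) : ∀ (xs ys : List ℕ) (i : ℕ),
    RungCert.unpackRowsZ B O (xs ++ ys) i = RungCert.unpackRowsZ B O xs i ++ RungCert.unpackRowsZ B O ys (i + xs.length)
  | [], ys, i => by simp [RungCert.unpackRowsZ]
  | x :: xs, ys, i => by
      have e : i + (x :: xs).length = (i + 1) + xs.length := by simp [List.length_cons]; omega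
      rw [List.cons_append, RungCert.unpackRowsZ, RungCert.unpackRowsZ, unpackRowsZ_append B O xs ys (i + 1), e,
        List.cons_append]

/-- `lzOK` of an appended factor. [folklore] -/
theorem lzOK_append (L₁ L₂ : List (List ℤ)) (n : ℕ) : lzOK (L₁ ++ L₂) n = (lzOK L₁ n && lzOK L₂ n) := by
  simp [lzOK, List.all_append]

/-- `absBoundOK` of an appended factor. [folklore] -/
theorem absBoundOK_append (Mx : ℕ) (L₁ L₂ : List (List ℤ)) :
    absBoundOK Mx (L₁ ++ L₂) = (absBoundOK Mx L₁ && absBoundOK Mx L₂) := by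
  simp [absBoundOK, List.all_append]

/-! ## §4 Assembly from the pieces -/

/-- ★ **`screwMatrix N ≻ 0` from separately decided pieces**: von Mangoldt rows and square roots validated to `N + 1`, log memberships,
a slope membership, the factor rows short, `0 < lamZ`, and every indexed row test of the integer domination check on the streamed table
`uTableNA lam sqs logs A N TB`. [folklore] -/
theorem posDef_of_pieces {N : ℕ} {lam : List (ℕ × ℕ × ℕ)} {sqs logs : List FI} {Lz : List (List ℤ)} {lamZ : ℤ} {A : FI} {TB : ℕ}
    (hlam : lamTabOK lam (N + 1) = true) (hsq : sqrtTabOK sqs (N + 1) = true)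
    (hL : ∀ n ≤ N + 1, FI.mem (Real.log n) (lg logs n)) (hA : FI.mem slopeA A) (hlz : lzOK Lz N = true) (hpos : 0 < lamZ)
    (hz : ∀ i < N, zrowW N (uTableNA lam sqs logs A N TB) Lz lamZ i = true) : (screwMatrix N).PosDef := by
  rcases Nat.eq_zero_or_pos N with rfl | hNpos
  · exact screwMatrix_zero_posDef
  set utab := uTableNA lam sqs logs A N TB with hutab
  have hut : ∀ a b : ℕ, 0 < b → b < a → a ≤ N + 1 → FI.mem (uR a b) (ug utab a b) := fun a b hb hba ha =>
    mem_ug_uTableNA (fun n hn => lamTabOK_sound hlam (n := n) hn) (fun n hn => mem_of_sqrtTabOK hsq (n := n) hn)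
      hL le_rfl hA TB hb hba ha
  have hcheck' := zcheck_of_zrowW hlz hz
  have hform : ∀ v : Fin N → ℝ, ((lamZ : ℤ) : ℝ) / (2 * SC) * dotProduct v v ≤
      dotProduct v ((tMat ((cLoF : ℚ) : ℝ) N).mulVec v) := by
    intro v
    rw [← quadForm_pad, ← sqSum_pad]
    refine mul_sqSum_le_quadForm_of_zcheck hcheck' (fun i hi j hj => ?_) _
    have hi' := mem_range.1 hi; have hj' := mem_range.1 hj
    unfold czOf rzOf
    rw [padM_of_lt _ hi' hj', pg_tzTab utab hi' hj']
    exact abs_sub_le_of_mem (mem_tEnclF hut hi' hj')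
  have hlam' : (0 : ℝ) < ((lamZ : ℤ) : ℝ) / (2 * SC) := by
    have : (0 : ℝ) < ((lamZ : ℤ) : ℝ) := by exact_mod_cast hpos
    exact div_pos this (mul_pos two_pos SC_pos)
  have hpd : (tMat ((cLoF : ℚ) : ℝ) N).PosDef := by
    refine Matrix.PosDef.of_dotProduct_mulVec_pos (tMat_isHermitian _ _) fun v hv => ?_
    have hvv : 0 < dotProduct v v := by
      have := Matrix.dotProduct_star_self_pos_iff.mpr hv
      simpa using this
    have := hform v
    rw [star_trivial]
    exact lt_of_lt_of_le (mul_pos hlam' hvv) this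
  rw [screwMatrix_eq_tMat, tMat_split lerchC ((cLoF : ℚ) : ℝ)]
  exact hpd.add_posSemidef ((one_add_vecMulVec_posSemidef N).smul
    (div_nonneg (sub_nonneg.2 cLoF_le_lerchC) (by norm_num)))

/-- **Quantitative form from the pieces**: `(lamZ/2^49)·‖v‖² ≤ vᵀ S_{N+1} v` for every real `v`. [folklore] -/
theorem quadForm_ge_of_pieces {N : ℕ} {lam : List (ℕ × ℕ × ℕ)} {sqs logs : List FI} {Lz : List (List ℤ)} {lamZ : ℤ} {A : FI}
    {TB : ℕ} (hlam : lamTabOK lam (N + 1) = true) (hsq : sqrtTabOK sqs (N + 1) = true)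
    (hL : ∀ n ≤ N + 1, FI.mem (Real.log n) (lg logs n)) (hA : FI.mem slopeA A) (hlz : lzOK Lz N = true)
    (hz : ∀ i < N, zrowW N (uTableNA lam sqs logs A N TB) Lz lamZ i = true) (v : Fin N → ℝ) :
    ((lamZ : ℤ) : ℝ) / (2 * SC) * (v ⬝ᵥ v) ≤ v ⬝ᵥ ((screwMatrix N).mulVec v) := by
  rcases Nat.eq_zero_or_pos N with rfl | hNpos
  · simp [dotProduct]
  set utab := uTableNA lam sqs logs A N TB with hutab
  have hut : ∀ a b : ℕ, 0 < b → b < a → a ≤ N + 1 → FI.mem (uR a b) (ug utab a b) := fun a b hb hba ha =>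
    mem_ug_uTableNA (fun n hn => lamTabOK_sound hlam (n := n) hn) (fun n hn => mem_of_sqrtTabOK hsq (n := n) hn)
      hL le_rfl hA TB hb hba ha
  have hcheck' := zcheck_of_zrowW hlz hz
  have hform : ((lamZ : ℤ) : ℝ) / (2 * SC) * (v ⬝ᵥ v) ≤ v ⬝ᵥ ((tMat ((cLoF : ℚ) : ℝ) N).mulVec v) := by
    rw [← quadForm_pad, ← sqSum_pad]
    refine mul_sqSum_le_quadForm_of_zcheck hcheck' (fun i hi j hj => ?_) _
    have hi' := Finset.mem_range.1 hi; have hj' := Finset.mem_range.1 hj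
    unfold czOf rzOf
    rw [padM_of_lt _ hi' hj', pg_tzTab utab hi' hj']
    exact abs_sub_le_of_mem (mem_tEnclF hut hi' hj')
  have hpsd := (one_add_vecMulVec_posSemidef N).smul
    (div_nonneg (sub_nonneg.2 cLoF_le_lerchC) (by norm_num : (0 : ℝ) ≤ 4))
  have h2 := hpsd.dotProduct_mulVec_nonneg v
  rw [star_trivial] at h2
  rw [screwMatrix_eq_tMat, tMat_split lerchC ((cLoF : ℚ) : ℝ), Matrix.add_mulVec, dotProduct_add]
  linarith

/-- Corollary: pivots `d_M > 0` for `2 ≤ M ≤ N + 1` from the pieces. [folklore] -/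
theorem screwPivot_pos_of_pieces {N : ℕ} {lam : List (ℕ × ℕ × ℕ)} {sqs logs : List FI} {Lz : List (List ℤ)} {lamZ : ℤ} {A : FI}
    {TB : ℕ} (hlam : lamTabOK lam (N + 1) = true) (hsq : sqrtTabOK sqs (N + 1) = true)
    (hL : ∀ n ≤ N + 1, FI.mem (Real.log n) (lg logs n)) (hA : FI.mem slopeA A) (hlz : lzOK Lz N = true) (hpos : 0 < lamZ)
    (hz : ∀ i < N, zrowW N (uTableNA lam sqs logs A N TB) Lz lamZ i = true) {M : ℕ} (hM : 2 ≤ M) (hMN : M ≤ N + 1) :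
    0 < screwPivot M :=
  screwPivot_pos_of_posDef_le (posDef_of_pieces hlam hsq hL hA hlz hpos hz) M hM hMN

end Summit.RiemannHypothesis.RiemannHypothesis.Theorems.IntegerScrew.RungCert
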